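import Summits.AtomisticToContinuum.FouriersLaw.Theorems.BondHeatUncertaintyLinearResponseFTURSchemePath
import Summits.AtomisticToContinuum.FouriersLaw.Theorems.BondHeatUncertaintyLinearResponseFTURLimitIdentification

/-!
# Convergence of the splitting scheme to the true path (Grönwall comparison; K3 helper)

Helper file for stub `stub_antiDampedGirsanov` (K3) of line `lebesgue-flip-duality`, crux ★
`BondHeatUncertainty.LinearResponseFTUR` (stmt-AtomisticToContinuum-9122); sequel of `…SchemePath.lean`.
Deterministic comparison, for ONE noise path, between the scheme path `z = D.path ε σ M y x` (frictionless
flow driven by the piecewise-linear scheme forcing) and a continuous reference path `X` on `[0, T]`,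
`T = M h`, solving the frictional equation with the UNCLAMPED friction direction
`Π(z) = p_0 e_0 + p_{N-1} e_{N-1}` (`frictionVec`):

  `X(s) = y + (ε n(s) - σγ ∫₀ˢ Π(X)) + ∫₀ˢ Y₀(X)`,

whose bath momenta stay below the clamp level (`|p_0(X)|, |p_{N-1}(X)| ≤ R` on `[0,T]`, so the clamp
is invisible along `X`). If both paths stay in a set on which `Y₀` is `L`-Lipschitz, then

  `‖z(s) - X(s)‖ ≤ (|ε|·w_n + 2|σγ|·T·w_z) · e^{(L + 2|σγ|) s}`      (`norm_path_sub_le`)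

where `w_n` bounds the distance between the piecewise-linear interpolation of the noise (the noise part
of the scheme forcing) and `n`, and `w_z` is a modulus of continuity of `z` over one time step. Proof:
the difference of the two integral equations; the friction terms are compared step by step
(`norm_frictionSum_sub_integral_le`: the frozen clamped impulses `h Π_R(z_j)` against `∫ Π(X)` over
the step, `Π_R` being `2`-Lipschitz), and Grönwall's inequality in integral form
(`Literature.Analysis.ODE.le_mul_exp_of_le_add_mul_integral_Icc`).
-/

noncomputable section

namespace Summit.AtomisticToContinuum.FouriersLaw.Theorems.LinearResponseFTUR

open MeasureTheory Filter Set Function Finset intervalIntegral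
open scoped NNReal
open Literature.MathematicalPhysics.KineticTheory
open Literature.MathematicalPhysics.KineticTheory.HeatConduction
open Literature.Analysis.ODE

variable {N : ℕ}

/-! ### The unclamped friction direction; Lipschitz bookkeeping -/

/-- The (unclamped) friction direction `Π(z) = p_0 e_0 + p_{N-1} e_{N-1}`. -/
def frictionVec (N : ℕ) (z : PhaseSpace N) : PhaseSpace N :=
  bathVec N 0 (leftMom N z) + bathVec N (N - 1) (rightMom N z)

/-- `leftMom` is `1`-Lipschitz. -/
theorem abs_leftMom_sub_le (z z' : PhaseSpace N) : |leftMom N z - leftMom N z'| ≤ ‖z - z'‖ := by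
  unfold leftMom
  split_ifs with h
  · exact abs_snd_sub_snd_le z z' _
  · simp

/-- `rightMom` is `1`-Lipschitz. -/
theorem abs_rightMom_sub_le (z z' : PhaseSpace N) : |rightMom N z - rightMom N z'| ≤ ‖z - z'‖ := by
  unfold rightMom
  split_ifs with h
  · exact abs_snd_sub_snd_le z z' _
  · simp

/-- `bathVec` is additive in the amplitude (restated outside the `SchemeData` namespace). -/
theorem bathVec_sub (N k : ℕ) (a b : ℝ) : bathVec N k a - bathVec N k b = bathVec N k (a - b) := by
  rw [sub_eq_add_neg, sub_eq_add_neg, SchemeData.bathVec_add]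
  congr 1
  ext i
  · simp [bathVec]
  · simp only [bathVec, Prod.snd_neg, Pi.neg_apply]
    split_ifs <;> ring

/-- **The clamped friction direction is `2`-Lipschitz.** -/
theorem norm_frictionImpulse_sub_le (R : ℝ) (z z' : PhaseSpace N) :
    ‖frictionImpulse N R z - frictionImpulse N R z'‖ ≤ 2 * ‖z - z'‖ := by
  unfold frictionImpulse
  have e : bathVec N 0 (clampR R (leftMom N z)) + bathVec N (N - 1) (clampR R (rightMom N z)) -
      (bathVec N 0 (clampR R (leftMom N z')) + bathVec N (N - 1) (clampR R (rightMom N z'))) =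
      bathVec N 0 (clampR R (leftMom N z) - clampR R (leftMom N z')) +
        bathVec N (N - 1) (clampR R (rightMom N z) - clampR R (rightMom N z')) := by
    rw [← bathVec_sub, ← bathVec_sub]; abel
  rw [e]
  refine (norm_add_le _ _).trans ?_
  have h1 := (norm_bathVec_le N 0 _).trans
    (((lipschitz_clampR R).dist_le_mul (leftMom N z) (leftMom N z')).trans_eq (by simp) |>.trans
      (le_of_eq (Real.dist_eq _ _)) |>.trans (abs_leftMom_sub_le z z'))
  have h2 := (norm_bathVec_le N (N - 1) _).trans
    (((lipschitz_clampR R).dist_le_mul (rightMom N z) (rightMom N z')).trans_eq (by simp) |>.trans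
      (le_of_eq (Real.dist_eq _ _)) |>.trans (abs_rightMom_sub_le z z'))
  linarith

/-- Where the bath momenta are below the clamp level, the clamped and unclamped friction directions
agree. -/
theorem frictionImpulse_eq_frictionVec {R : ℝ} {z : PhaseSpace N} (hL : |leftMom N z| ≤ R)
    (hR : |rightMom N z| ≤ R) : frictionImpulse N R z = frictionVec N z := by
  unfold frictionImpulse frictionVec
  rw [clampR_of_abs_le hL, clampR_of_abs_le hR]

/-- `frictionVec` is continuous. -/
theorem continuous_frictionVec (N : ℕ) : Continuous (frictionVec N) := by
  have hb : ∀ k : ℕ, Continuous fun c : ℝ => bathVec N k c := by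
    intro k
    refine continuous_const.prodMk (continuous_pi fun i => ?_)
    by_cases hi : i.val = k
    · simp only [hi, if_true]; exact continuous_id
    · simp only [hi, if_false]; exact continuous_const
  have hl : Continuous (leftMom N) := by
    unfold leftMom; split_ifs
    · exact (continuous_apply _).comp continuous_snd
    · exact continuous_const
  have hr : Continuous (rightMom N) := by
    unfold rightMom; split_ifs
    · exact (continuous_apply _).comp continuous_snd
    · exact continuous_const
  unfold frictionVec
  exact ((hb 0).comp hl).add ((hb (N - 1)).comp hr)

/-! ### Every time in `[0, M h]` lies in a step -/

/-- Every `s ∈ [0, M h]` (`M ≥ 1`, `h > 0`) is `k h + r` with `k < M`, `r ∈ [0, h]`. -/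
theorem exists_step_decomp {h : ℝ} (hh : 0 < h) {M : ℕ} (hM : 0 < M) {s : ℝ} (hs : s ∈ Icc 0 (M * h)) :
    ∃ k : ℕ, k < M ∧ ∃ r ∈ Icc 0 h, s = k * h + r := by
  rcases eq_or_lt_of_le hs.2 with heq | hlt
  · refine ⟨M - 1, Nat.sub_lt hM one_pos, h, ⟨hh.le, le_rfl⟩, ?_⟩
    rw [heq, Nat.cast_pred hM]; ring
  · set k := ⌊s / h⌋₊ with hk
    have hk1 : (k : ℝ) ≤ s / h := Nat.floor_le (div_nonneg hs.1 hh.le)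
    have hk2 : s / h < k + 1 := Nat.lt_floor_add_one _
    have hkM : k < M := by
      have : (k : ℝ) < M := by
        have h1 : s / h < M := (div_lt_iff₀ hh).2 (by linarith)
        linarith
      exact_mod_cast this
    refine ⟨k, hkM, s - k * h, ⟨?_, ?_⟩, by ring⟩
    · have := (le_div_iff₀ hh).1 hk1; linarith
    · have := (div_lt_iff₀ hh).1 hk2; nlinarith

namespace SchemeData

variable {D : SchemeData N} {ε σ : ℝ} {M : ℕ} {y : PhaseSpace N} {x : ℕ → ℝ × ℝ}

/-- The scheme forcing splits into its NOISE part (the piecewise-linear interpolation of the noise) and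
its FRICTION part. -/
theorem forcing_eq_noise_sub_friction (hh : D.h ≠ 0) (s : ℝ) :
    D.forcing ε σ M y x s =
      ε • ∑ j ∈ Finset.range M, (stepFrac D.h j s / D.h) • noiseImpulse N D.cL D.cR (x j) -
        (σ * D.γ) • ∑ j ∈ Finset.range M, stepFrac D.h j s • frictionImpulse N D.R (D.state ε σ y x j) := by
  unfold forcing impulse
  rw [Finset.smul_sum, Finset.smul_sum, ← Finset.sum_sub_distrib]
  refine Finset.sum_congr rfl fun j _ => ?_
  rw [smul_sub, smul_comm (stepFrac D.h j s / D.h) ε, smul_smul, smul_smul, smul_smul]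
  congr 1
  congr 1
  field_simp

/-- **The friction part of the forcing against the friction integral of the reference path, over the
elapsed steps.** For `s = k h + r` (`k < M`, `r ∈ [0,h]`), a continuous reference path `X` with bath
momenta below `R` on `[0, M h]`, the scheme path `z` (through the states `z_j = z(jh)`), a modulus `w_z`
of `z` over one step and `e = ‖z - X‖`:
`‖Σ_j stepFrac_j(s) Π_R(z_j) - ∫₀ˢ Π(X)‖ ≤ 2 ∫₀ˢ e + 2 s w_z`. -/
theorem norm_frictionSum_sub_integral_le (D₀ : ConfinedDrift D.Y₀) (hD₀ : D₀.noise = momentumSubspace N)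
    (hh : 0 < D.h) {X : ℝ → PhaseSpace N} (hXc : Continuous X)
    (hXR : ∀ s ∈ Icc 0 (M * D.h), |leftMom N (X s)| ≤ D.R ∧ |rightMom N (X s)| ≤ D.R)
    {wz : ℝ} (hwz : ∀ r ∈ Icc 0 (M * D.h), ∀ r' ∈ Icc 0 (M * D.h), |r - r'| ≤ D.h →
      ‖D.path ε σ M y x r - D.path ε σ M y x r'‖ ≤ wz)
    {k : ℕ} (hk : k < M) {r : ℝ} (hr : r ∈ Icc 0 D.h) :
    ‖(∑ j ∈ Finset.range M, stepFrac D.h j (k * D.h + r) • frictionImpulse N D.R (D.state ε σ y x j)) -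
        ∫ u in (0 : ℝ)..(k * D.h + r), frictionVec N (X u)‖ ≤
      2 * (∫ u in (0 : ℝ)..(k * D.h + r), ‖D.path ε σ M y x u - X u‖) + 2 * (k * D.h + r) * wz := by
  set z := D.path ε σ M y x with hz
  have hzc : Continuous z := SchemeData.continuous_path D₀ hD₀
  have hec : Continuous fun u => ‖z u - X u‖ := (hzc.sub hXc).norm
  have hPic : Continuous fun u => frictionVec N (X u) := (continuous_frictionVec N).comp hXc
  have hT0 : (0 : ℝ) ≤ M * D.h := mul_nonneg M.cast_nonneg hh.le
  have hkh : (k : ℝ) * D.h + D.h ≤ M * D.h := by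
    have : (k : ℝ) + 1 ≤ M := by exact_mod_cast hk
    nlinarith
  -- pointwise bound on step `j ≤ k`: for `u ∈ [jh, jh + h] ∩ [0, Mh]`
  have hpt : ∀ (j : ℕ), j ≤ k → ∀ u, (j : ℝ) * D.h ≤ u → u ≤ j * D.h + D.h → u ≤ M * D.h →
      ‖frictionImpulse N D.R (D.state ε σ y x j) - frictionVec N (X u)‖ ≤ 2 * (‖z u - X u‖ + wz) := by
    intro j hj u hu1 hu2 hu3
    have hjM : j ≤ M := hj.trans hk.le
    have hju : (0 : ℝ) ≤ j * D.h := mul_nonneg j.cast_nonneg hh.le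
    have hu0 : 0 ≤ u := hju.trans hu1
    have hnode : z (j * D.h) = D.state ε σ y x j := SchemeData.path_grid D₀ hD₀ hh hjM
    obtain ⟨hl, hrr⟩ := hXR u ⟨hu0, hu3⟩
    rw [← frictionImpulse_eq_frictionVec hl hrr, ← hnode]
    refine (norm_frictionImpulse_sub_le D.R _ _).trans ?_
    have hjT : (j : ℝ) * D.h ∈ Icc 0 (M * D.h) := ⟨hju, by
      have : (j : ℝ) ≤ M := by exact_mod_cast hjM
      nlinarith⟩
    have hw := hwz (j * D.h) hjT u ⟨hu0, hu3⟩ (by rw [abs_le]; constructor <;> linarith)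
    have : ‖z (j * D.h) - X u‖ ≤ ‖z (j * D.h) - z u‖ + ‖z u - X u‖ := norm_sub_le_norm_sub_add_norm_sub _ _ _
    linarith
  -- the sum as a sum of step integrals of constants
  have hsum : (∑ j ∈ Finset.range M, stepFrac D.h j (k * D.h + r) • frictionImpulse N D.R (D.state ε σ y x j)) =
      (∑ j ∈ Finset.range k, ∫ u in ((j : ℕ) : ℝ) * D.h..((j + 1 : ℕ) : ℝ) * D.h,
          frictionImpulse N D.R (D.state ε σ y x j)) +
        ∫ u in (k : ℝ) * D.h..(k * D.h + r), frictionImpulse N D.R (D.state ε σ y x k) := by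
    simp_rw [stepFrac_grid_add hh _ k hr, intervalIntegral.integral_const]
    have hsplit : Finset.range M = Finset.range (k + 1) ∪ (Finset.range M \ Finset.range (k + 1)) := by
      ext j; simp only [Finset.mem_range, Finset.mem_union, Finset.mem_sdiff]; omega
    rw [hsplit, Finset.sum_union Finset.disjoint_sdiff, Finset.sum_range_succ]
    have hz0 : ∑ j ∈ Finset.range M \ Finset.range (k + 1),
        (if j < k then D.h else if j = k then r else 0) • frictionImpulse N D.R (D.state ε σ y x j) = 0 := by
      refine Finset.sum_eq_zero fun j hj => ?_
      simp only [Finset.mem_sdiff, Finset.mem_range] at hj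
      rw [if_neg (by omega), if_neg (by omega), zero_smul]
    rw [hz0, add_zero, if_neg (lt_irrefl k), if_pos rfl]
    congr 1
    · refine Finset.sum_congr rfl fun j hj => ?_
      rw [if_pos (Finset.mem_range.1 hj)]
      congr 1
      push_cast; ring
    · congr 1; ring
  -- the reference integral split along the same steps
  have hint : ∀ a b : ℝ, IntervalIntegrable (fun u => frictionVec N (X u)) volume a b :=
    fun a b => hPic.intervalIntegrable _ _
  have hXsplit : ∫ u in (0 : ℝ)..(k * D.h + r), frictionVec N (X u) =
      (∑ j ∈ Finset.range k, ∫ u in ((j : ℕ) : ℝ) * D.h..((j + 1 : ℕ) : ℝ) * D.h, frictionVec N (X u)) +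
        ∫ u in (k : ℝ) * D.h..(k * D.h + r), frictionVec N (X u) := by
    rw [intervalIntegral.sum_integral_adjacent_intervals (fun j _ => hint _ _)]
    simp only [Nat.cast_zero, zero_mul]
    rw [intervalIntegral.integral_add_adjacent_intervals (hint _ _) (hint _ _)]
  rw [hsum, hXsplit, add_sub_add_comm, ← Finset.sum_sub_distrib]
  -- bound each piece
  have hpiece : ∀ (j : ℕ), j ≤ k → ∀ {b : ℝ}, (j : ℝ) * D.h ≤ b → b ≤ j * D.h + D.h → b ≤ M * D.h →
      ‖(∫ u in (j : ℝ) * D.h..b, frictionImpulse N D.R (D.state ε σ y x j)) -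
          ∫ u in (j : ℝ) * D.h..b, frictionVec N (X u)‖ ≤
        ∫ u in (j : ℝ) * D.h..b, 2 * (‖z u - X u‖ + wz) := by
    intro j hj b hb1 hb2 hb3
    rw [← intervalIntegral.integral_sub intervalIntegrable_const (hint _ _)]
    refine intervalIntegral.norm_integral_le_of_norm_le hb1 (Eventually.of_forall fun u hu => ?_) ?_
    · exact hpt j hj u hu.1.le (hu.2.trans hb2) (hu.2.trans hb3)
    · exact ((hec.add continuous_const).const_mul 2).intervalIntegrable _ _
  calc ‖(∑ j ∈ Finset.range k, ((∫ u in ((j : ℕ) : ℝ) * D.h..((j + 1 : ℕ) : ℝ) * D.h,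
            frictionImpulse N D.R (D.state ε σ y x j)) -
            ∫ u in ((j : ℕ) : ℝ) * D.h..((j + 1 : ℕ) : ℝ) * D.h, frictionVec N (X u))) +
          ((∫ u in (k : ℝ) * D.h..(k * D.h + r), frictionImpulse N D.R (D.state ε σ y x k)) -
            ∫ u in (k : ℝ) * D.h..(k * D.h + r), frictionVec N (X u))‖
      ≤ (∑ j ∈ Finset.range k, ∫ u in ((j : ℕ) : ℝ) * D.h..((j + 1 : ℕ) : ℝ) * D.h, 2 * (‖z u - X u‖ + wz)) +
          ∫ u in (k : ℝ) * D.h..(k * D.h + r), 2 * (‖z u - X u‖ + wz) := by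
        refine (norm_add_le _ _).trans (add_le_add ((norm_sum_le _ _).trans (Finset.sum_le_sum fun j hj => ?_)) ?_)
        · have hjk : j < k := Finset.mem_range.1 hj
          have e1 : ((j + 1 : ℕ) : ℝ) * D.h = (j : ℝ) * D.h + D.h := by push_cast; ring
          rw [e1]
          refine hpiece j hjk.le (by linarith) le_rfl ?_
          have : (j : ℝ) + 1 ≤ k := by exact_mod_cast hjk
          nlinarith [hr.1]
        · exact hpiece k le_rfl (by linarith [hr.1]) (by linarith [hr.2]) (by linarith [hr.2])
    _ = ∫ u in (0 : ℝ)..(k * D.h + r), 2 * (‖z u - X u‖ + wz) := by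
        have hint2 : ∀ a b : ℝ, IntervalIntegrable (fun u => 2 * (‖z u - X u‖ + wz)) volume a b :=
          fun a b => ((hec.add continuous_const).const_mul 2).intervalIntegrable _ _
        rw [intervalIntegral.sum_integral_adjacent_intervals (fun j _ => hint2 _ _)]
        simp only [Nat.cast_zero, zero_mul]
        rw [intervalIntegral.integral_add_adjacent_intervals (hint2 _ _) (hint2 _ _)]
    _ = 2 * (∫ u in (0 : ℝ)..(k * D.h + r), ‖z u - X u‖) + 2 * (k * D.h + r) * wz := by
        rw [intervalIntegral.integral_const_mul, intervalIntegral.integral_add (hec.intervalIntegrable _ _)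
          intervalIntegrable_const, intervalIntegral.integral_const, smul_eq_mul]
        ring

/-- **The scheme converges to the reference path (Grönwall comparison).** See the module docstring. -/
theorem norm_path_sub_le (D₀ : ConfinedDrift D.Y₀) (hD₀ : D₀.noise = momentumSubspace N)
    (hh : 0 < D.h) (hM : 0 < M) {X : ℝ → PhaseSpace N} (hXc : Continuous X) {n : ℝ → PhaseSpace N}
    (hXeq : ∀ s ∈ Icc 0 (M * D.h), X s = y + (ε • n s - (σ * D.γ) • ∫ u in (0 : ℝ)..s, frictionVec N (X u)) +
      ∫ u in (0 : ℝ)..s, D.Y₀ (X u))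
    (hXR : ∀ s ∈ Icc 0 (M * D.h), |leftMom N (X s)| ≤ D.R ∧ |rightMom N (X s)| ≤ D.R)
    {S : Set (PhaseSpace N)} {L : ℝ≥0} (hL : LipschitzOnWith L D.Y₀ S)
    (hXS : ∀ s ∈ Icc 0 (M * D.h), X s ∈ S) (hzS : ∀ s ∈ Icc 0 (M * D.h), D.path ε σ M y x s ∈ S)
    {wn wz : ℝ}
    (hwn : ∀ s ∈ Icc 0 (M * D.h),
      ‖(∑ j ∈ Finset.range M, (stepFrac D.h j s / D.h) • noiseImpulse N D.cL D.cR (x j)) - n s‖ ≤ wn)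
    (hwz : ∀ r ∈ Icc 0 (M * D.h), ∀ r' ∈ Icc 0 (M * D.h), |r - r'| ≤ D.h →
      ‖D.path ε σ M y x r - D.path ε σ M y x r'‖ ≤ wz) :
    ∀ s ∈ Icc 0 (M * D.h), ‖D.path ε σ M y x s - X s‖ ≤
      (|ε| * wn + |σ * D.γ| * (2 * (M * D.h) * wz)) * Real.exp (((L : ℝ) + 2 * |σ * D.γ|) * s) := by
  set z := D.path ε σ M y x with hz
  set T : ℝ := M * D.h with hT
  have hT0 : 0 ≤ T := mul_nonneg M.cast_nonneg hh.le
  have hzc : Continuous z := SchemeData.continuous_path D₀ hD₀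
  have hec : Continuous fun u => ‖z u - X u‖ := (hzc.sub hXc).norm
  have hwz0 : 0 ≤ wz := (norm_nonneg _).trans (hwz 0 ⟨le_rfl, hT0⟩ 0 ⟨le_rfl, hT0⟩ (by simp [hh.le]))
  refine le_mul_exp_of_le_add_mul_integral_Icc hec.continuousOn (by positivity) fun s hs => ?_
  -- write `s = kh + r`
  obtain ⟨k, hk, r, hr, hsr⟩ := exists_step_decomp hh hM hs
  -- the two integral equations
  have hzeq : z s = y + D.forcing ε σ M y x s + ∫ u in (0 : ℝ)..s, D.Y₀ (z u) :=
    SchemeData.path_eq_integral D₀ hD₀ s hs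
  have hXeqs := hXeq s hs
  have hF := D.forcing_eq_noise_sub_friction (ε := ε) (σ := σ) (M := M) (y := y) (x := x) hh.ne' s
  -- continuity of the drift along both paths on `[0, T]`
  have hsub : Icc 0 s ⊆ Icc 0 T := Icc_subset_Icc_right hs.2
  have hco : ∀ {w : ℝ → PhaseSpace N}, Continuous w → (∀ t ∈ Icc 0 T, w t ∈ S) →
      ContinuousOn (fun u => D.Y₀ (w u)) (Icc 0 T) := fun hw hS =>
    hL.continuousOn.comp hw.continuousOn hS
  have hi₁ : IntervalIntegrable (fun u => D.Y₀ (z u)) volume 0 s :=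
    ((hco hzc hzS).mono hsub).intervalIntegrable_of_Icc hs.1
  have hi₂ : IntervalIntegrable (fun u => D.Y₀ (X u)) volume 0 s :=
    ((hco hXc hXS).mono hsub).intervalIntegrable_of_Icc hs.1
  -- the difference
  have hdiff : z s - X s =
      (ε • ((∑ j ∈ Finset.range M, (stepFrac D.h j s / D.h) • noiseImpulse N D.cL D.cR (x j)) - n s) -
        (σ * D.γ) • ((∑ j ∈ Finset.range M, stepFrac D.h j s • frictionImpulse N D.R (D.state ε σ y x j)) -
          ∫ u in (0 : ℝ)..s, frictionVec N (X u))) +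
        ∫ u in (0 : ℝ)..s, (D.Y₀ (z u) - D.Y₀ (X u)) := by
    rw [intervalIntegral.integral_sub hi₁ hi₂, hzeq, hXeqs, hF, smul_sub, smul_sub]
    abel
  rw [hdiff]
  have hfric := SchemeData.norm_frictionSum_sub_integral_le D₀ hD₀ hh hXc hXR hwz hk hr
  rw [← hsr] at hfric
  have hdrift : ‖∫ u in (0 : ℝ)..s, (D.Y₀ (z u) - D.Y₀ (X u))‖ ≤ ∫ u in (0 : ℝ)..s, (L : ℝ) * ‖z u - X u‖ := by
    refine intervalIntegral.norm_integral_le_of_norm_le hs.1 (Eventually.of_forall fun u hu => ?_) ?_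
    · have hu' : u ∈ Icc 0 T := ⟨hu.1.le, hu.2.trans hs.2⟩
      exact hL.norm_sub_le (hzS u hu') (hXS u hu')
    · exact (hec.const_mul (L : ℝ)).intervalIntegrable _ _
  have hint0 : 0 ≤ ∫ u in (0 : ℝ)..s, ‖z u - X u‖ :=
    intervalIntegral.integral_nonneg hs.1 fun u _ => norm_nonneg _
  calc ‖ε • ((∑ j ∈ Finset.range M, (stepFrac D.h j s / D.h) • noiseImpulse N D.cL D.cR (x j)) - n s) -
          (σ * D.γ) • ((∑ j ∈ Finset.range M, stepFrac D.h j s • frictionImpulse N D.R (D.state ε σ y x j)) -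
            ∫ u in (0 : ℝ)..s, frictionVec N (X u)) +
          ∫ u in (0 : ℝ)..s, (D.Y₀ (z u) - D.Y₀ (X u))‖
      ≤ |ε| * wn + |σ * D.γ| * (2 * (∫ u in (0 : ℝ)..s, ‖z u - X u‖) + 2 * s * wz) +
          ∫ u in (0 : ℝ)..s, (L : ℝ) * ‖z u - X u‖ := by
        refine (norm_add_le _ _).trans (add_le_add ((norm_sub_le _ _).trans (add_le_add ?_ ?_)) hdrift)
        · rw [norm_smul, Real.norm_eq_abs]
          exact mul_le_mul_of_nonneg_left (hwn s hs) (abs_nonneg _)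
        · rw [norm_smul, Real.norm_eq_abs]
          exact mul_le_mul_of_nonneg_left hfric (abs_nonneg _)
    _ ≤ (|ε| * wn + |σ * D.γ| * (2 * (M * D.h) * wz)) +
          ((L : ℝ) + 2 * |σ * D.γ|) * ∫ u in (0 : ℝ)..s, ‖z u - X u‖ := by
        rw [intervalIntegral.integral_const_mul]
        have h1 : |σ * D.γ| * (2 * s * wz) ≤ |σ * D.γ| * (2 * (M * D.h) * wz) :=
          mul_le_mul_of_nonneg_left (by nlinarith [hs.2, hwz0, hs.1]) (abs_nonneg _)
        nlinarith [h1, abs_nonneg (σ * D.γ), hint0]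

end SchemeData

/-- **The splitting scheme converges to the flow on the good event** — `∀`-form of
`SchemeData.norm_path_sub_le` (registered sub-goal of the crux item). -/
theorem scheme_norm_path_sub_le :
    ∀ (N : ℕ) (D : SchemeData N) (D₀ : ConfinedDrift D.Y₀), D₀.noise = momentumSubspace N → 0 < D.h → ∀ (ε σ : ℝ) (M : ℕ), 0 < M → ∀ (y : PhaseSpace N) (x : ℕ → ℝ × ℝ) (X n : ℝ → PhaseSpace N), Continuous X → (∀ s ∈ Icc 0 ((M : ℝ) * D.h), X s = y + (ε • n s - (σ * D.γ) • ∫ u in (0 : ℝ)..s, frictionVec N (X u)) + ∫ u in (0 : ℝ)..s, D.Y₀ (X u)) → (∀ s ∈ Icc 0 ((M : ℝ) * D.h), |leftMom N (X s)| ≤ D.R ∧ |rightMom N (X s)| ≤ D.R) → ∀ (S : Set (PhaseSpace N)) (L : ℝ≥0), LipschitzOnWith L D.Y₀ S → (∀ s ∈ Icc 0 ((M : ℝ) * D.h), X s ∈ S) → (∀ s ∈ Icc 0 ((M : ℝ) * D.h), D.path ε σ M y x s ∈ S) → ∀ (wn wz : ℝ), (∀ s ∈ Icc 0 ((M : ℝ)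 * D.h), ‖(∑ j ∈ Finset.range M, (stepFrac D.h j s / D.h) • noiseImpulse N D.cL D.cR (x j)) - n s‖ ≤ wn) → (∀ r ∈ Icc 0 ((M : ℝ) * D.h), ∀ r' ∈ Icc 0 ((M : ℝ) * D.h), |r - r'| ≤ D.h → ‖D.path ε σ M y x r - D.path ε σ M y x r'‖ ≤ wz) → ∀ s ∈ Icc 0 ((M : ℝ) * D.h), ‖D.path ε σ M y x s - X s‖ ≤ (|ε| * wn + |σ * D.γ| * (2 * ((M : ℝ) * D.h) * wz)) * Real.exp (((L : ℝ) + 2 * |σ * D.γ|) * s) :=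
  fun _ _ D₀ hD₀ hh _ _ _ hM _ _ _ _ hXc hXeq hXR _ _ hL hXS hzS _ _ hwn hwz =>
    SchemeData.norm_path_sub_le D₀ hD₀ hh hM hXc hXeq hXR hL hXS hzS hwn hwz

end Summit.AtomisticToContinuum.FouriersLaw.Theorems.LinearResponseFTUR

end
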